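/-
Copyright: rh-split cell, seat prover-l1-w2 (L1 «DUST WALL», width seat 2), 2026-08-27.  Splitting search
over kernel-typed RH-equivalences; a splitting `A ∧ B ⟹ RH` is conditional bookkeeping unless `A` and
`B` are both proved.  Nothing here bears on the truth of RH.
-/
import Summits.RiemannHypothesis.RiemannHypothesis.Theorems.Splittings.ScrewDustCycleRow
import Summits.RiemannHypothesis.RiemannHypothesis.Theorems.Splittings.ScrewDustZorettiMoat
import HarnessLib

/-!
# Gauss's law for LINKED COMPACTA: a compact subset of `Ω₀(h)` enclosing a far zero is a grid cycle

The cycle row `CEIL(h) ∧ CENC(h) ⟺ RH` of `ScrewDustCycleRow` asks for a wall-free GRID CYCLE of the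
origin's component `Ω₀(h)` around an aliased far zero.  Here the combinatorial certificate is replaced
by plane topology:

* `ScrewDust.exists_cellComplex_of_isBounded_component` (§1, plane geometry): if `K` is compact inside
  an open `U ⊆ 𝔻` and `p ∉ K` lies in a BOUNDED component of `ℂ ∖ K`, then a finite complex of grid
  cells inside `𝔻` — the cells meeting that component, of small mesh, on lines avoiding a given
  countable set `T ∋ p` — has all its exposed edges in `U` and `p` in an open cell (a segment inside a
  cell from a point of the component to a point off it crosses `∂(component) ⊆ K`, so exposed edges
  are `2·mesh`-close to `K`).  With Gauss's law for grid cycles (`ScrewDustCycleGauss`) this gives the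
  ζ-free **GAUSS LAW FOR COMPACTA** `ScrewDust.not_isBounded_component_of_compact`: a blind
  continuation lets no compact subset of `Ω₀` link an inside pole.
* `LINKED(h)` (`Linked h`, §2): some compact `K ⊆ Ω₀(h)` has an aliased far zero in a bounded
  component of `ℂ ∖ K`.  `ENC(h) ⟹ LINKED(h) ⟹ CENC(h)` (`linked_of_encirclable`,
  `cycleEncirclable_of_linked`), and the row `latticeCeiling_and_linked_iff_rh`: `CEIL(h) ∧ LINKED(h)
  ⟺ RH` for every `h > 0`.  RH-free reading (`latticeCeiling_dichotomy_linked`, GAUSS'S LAW FOR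
  COMPACTA): under `CEIL(h)`, either RH holds or every aliased far zero lies in the UNBOUNDED
  component of the complement of every compact subset of `Ω₀(h)` — no compact piece of the origin's
  component links a far zero.

No `sorry`, no new axioms, no instances, no notation; one `@[conjecture] def` (`Linked`).
-/

set_option linter.dupNamespace false

/-! ## 1. Plane geometry: a compactum with a bounded complementary component is shadowed by a grid cycle -/

namespace Summit.RiemannHypothesis.RiemannHypothesis.Theorems.Splittings.ScrewDust

open Complex Filter Topology Set Metric Bornology
open scoped Classical
open Literature.Topology.PlaneTopology
open Literature.Probability.RandomPlanarGeometry (convex_reProdIm)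
open Summit.RiemannHypothesis.RiemannHypothesis.Theorems.Splittings.ScrewBorel

/-- A bounded component of the complement of a set `K ⊆ ball 0 r` (`r ≥ 0`) lies in `closedBall 0 r`:
the connected exterior `{w | r < ‖w‖}` misses `K` and is unbounded. -/
theorem component_subset_closedBall {K : Set ℂ} {r : ℝ} (hr : 0 ≤ r) (hK : K ⊆ ball (0 : ℂ) r)
    {p : ℂ} (hD : IsBounded (connectedComponentIn Kᶜ p)) :
    connectedComponentIn Kᶜ p ⊆ closedBall (0 : ℂ) r := by
  intro z hz
  by_contra hzr
  rw [mem_closedBall_zero_iff, not_le] at hzr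
  have hE : {w : ℂ | r < ‖w‖} ⊆ connectedComponentIn Kᶜ p := by
    rw [connectedComponentIn_eq hz]
    refine (isConnected_setOf_lt_norm hr).isPreconnected.subset_connectedComponentIn
      (mem_setOf.2 hzr) fun w hw hwK ↦ ?_
    have := mem_ball_zero_iff.1 (hK hwK)
    exact absurd this (not_lt.2 (le_of_lt (mem_setOf.1 hw)))
  obtain ⟨C, hC⟩ := (isBounded_iff_subset_closedBall (0 : ℂ)).1 hD
  set w : ℂ := ((max C r + 1 : ℝ) : ℂ) with hw
  have hwn : ‖w‖ = max C r + 1 := by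
    rw [hw, Complex.norm_real, Real.norm_eq_abs, abs_of_pos]
    linarith [le_max_right C r]
  have h1 : w ∈ {w : ℂ | r < ‖w‖} := by
    rw [mem_setOf, hwn]; linarith [le_max_right C r]
  have h2 := mem_closedBall_zero_iff.1 (hC (hE h1))
  rw [hwn] at h2
  linarith [le_max_left C r]

/-- Points of the closure of a component of `Kᶜ` that are not in the component lie in `K`. -/
theorem mem_of_mem_closure_component {K : Set ℂ} (hK : IsClosed K) {p v : ℂ}
    (hv : v ∈ closure (connectedComponentIn Kᶜ p)) (hvD : v ∉ connectedComponentIn Kᶜ p) :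
    v ∈ K := by
  by_contra hvK
  exact hvD (mem_connectedComponentIn_of_mem_closure hK.isOpen_compl hv hvK)

/-- **A linked compactum is a grid cycle.**  Let `U ⊆ 𝔻` be open, `K ⊆ U` compact, `T` countable,
`p ∈ T ∖ K` with BOUNDED component in `ℂ ∖ K`.  Then there are a grid `x, y` (uniform, non-decreasing)
and a finite complex `H` of its closed cells inside `𝔻` with `T` in general position (each point of `T`
in an open cell or off the closed cell, for every cell), every EXPOSED edge of `H` inside `U`, and `p`
in an open cell of `H`.  (`H` = cells meeting the component of `p`, mesh below a thickening radius of
`K` inside `U` and below the distance of `K` to the unit circle.) -/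
theorem exists_cellComplex_of_isBounded_component {T : Set ℂ} (hT : T.Countable) {U : Set ℂ}
    (hU : IsOpen U) (hU1 : U ⊆ ball (0 : ℂ) 1) {K : Set ℂ} (hK : IsCompact K) (hKU : K ⊆ U)
    {p : ℂ} (hpT : p ∈ T) (hpK : p ∉ K) (hD : IsBounded (connectedComponentIn Kᶜ p)) :
    ∃ (x y : ℤ → ℝ) (H : Finset (ℤ × ℤ)),
      (∀ m, x m ≤ x (m + 1)) ∧ (∀ n, y n ≤ y (n + 1)) ∧
      (∀ k ∈ H, Icc (x k.1) (x (k.1 + 1)) ×ℂ Icc (y k.2) (y (k.2 + 1)) ⊆ ball (0 : ℂ) 1) ∧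
      (∀ q ∈ T, ∀ k : ℤ × ℤ, q ∈ Ioo (x k.1) (x (k.1 + 1)) ×ℂ Ioo (y k.2) (y (k.2 + 1)) ∨
        q ∉ Icc (x k.1) (x (k.1 + 1)) ×ℂ Icc (y k.2) (y (k.2 + 1))) ∧
      (∀ k ∈ H, (k.1, k.2 - 1) ∉ H →
        (fun t : ℝ ↦ (t : ℂ) + y k.2 * I) '' Icc (x k.1) (x (k.1 + 1)) ⊆ U) ∧
      (∀ k ∈ H, (k.1, k.2 + 1) ∉ H →
        (fun t : ℝ ↦ (t : ℂ) + y (k.2 + 1) * I) '' Icc (x k.1) (x (k.1 + 1)) ⊆ U) ∧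
      (∀ k ∈ H, (k.1 - 1, k.2) ∉ H →
        (fun t : ℝ ↦ (x k.1 : ℂ) + t * I) '' Icc (y k.2) (y (k.2 + 1)) ⊆ U) ∧
      (∀ k ∈ H, (k.1 + 1, k.2) ∉ H →
        (fun t : ℝ ↦ (x (k.1 + 1) : ℂ) + t * I) '' Icc (y k.2) (y (k.2 + 1)) ⊆ U) ∧
      ∃ k ∈ H, p ∈ Ioo (x k.1) (x (k.1 + 1)) ×ℂ Ioo (y k.2) (y (k.2 + 1)) := by
  -- the component `D` of `p`, a radius `r₀ < 1` with `D ⊆ closedBall 0 r₀`, a thickening of `K` in `U`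
  set D : Set ℂ := connectedComponentIn Kᶜ p with hD_def
  have hDo : IsOpen D := hK.isClosed.isOpen_compl.connectedComponentIn
  have hpD : p ∈ D := mem_connectedComponentIn hpK
  obtain ⟨r, hr1, hKr⟩ := exists_lt_subset_ball hK.isClosed (hKU.trans hU1)
  set r₀ : ℝ := max r 0 with hr₀
  have hr₀0 : 0 ≤ r₀ := le_max_right _ _
  have hr₀1 : r₀ < 1 := max_lt hr1 one_pos
  have hKr₀ : K ⊆ ball (0 : ℂ) r₀ := hKr.trans (ball_subset_ball (le_max_left _ _))
  have hDr : D ⊆ closedBall (0 : ℂ) r₀ := component_subset_closedBall hr₀0 hKr₀ hD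
  obtain ⟨η, hη, hηU⟩ := hK.exists_thickening_subset_open hU hKU
  set δ : ℝ := min (η / 4) ((1 - r₀) / 4) with hδ_def
  have hδ : 0 < δ := lt_min (by positivity) (by linarith)
  have h2δη : 2 * δ < η := by have := min_le_left (η / 4) ((1 - r₀) / 4); linarith
  have h2δr : r₀ + 2 * δ < 1 := by have := min_le_right (η / 4) ((1 - r₀) / 4); linarith
  obtain ⟨a₁, a₂, hT₁, hT₂⟩ := exists_grid_avoiding hT δ
  set x : ℤ → ℝ := fun m ↦ a₁ + δ * m with hx_def
  set y : ℤ → ℝ := fun n ↦ a₂ + δ * n with hy_def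
  have hx : ∀ m, x m = a₁ + δ * m := fun _ ↦ rfl
  have hy : ∀ n, y n = a₂ + δ * n := fun _ ↦ rfl
  have hxle : ∀ m, x m ≤ x (m + 1) := grid_le_succ hx hδ.le
  have hyle : ∀ n, y n ≤ y (n + 1) := grid_le_succ hy hδ.le
  -- the complex: cells meeting `D`, inside a finite box of indices
  set H : Finset (ℤ × ℤ) := ((Finset.Icc (⌊((0 : ℂ).re - r₀ - a₁) / δ⌋ - 1)
      ⌈((0 : ℂ).re + r₀ - a₁) / δ⌉) ×ˢ (Finset.Icc (⌊((0 : ℂ).im - r₀ - a₂) / δ⌋ - 1)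
      ⌈((0 : ℂ).im + r₀ - a₂) / δ⌉)).filter fun k ↦
    ((Icc (x k.1) (x (k.1 + 1)) ×ℂ Icc (y k.2) (y (k.2 + 1))) ∩ D).Nonempty with hH_def
  have hHmem : ∀ k : ℤ × ℤ, k ∈ H ↔
      ((Icc (x k.1) (x (k.1 + 1)) ×ℂ Icc (y k.2) (y (k.2 + 1))) ∩ D).Nonempty := by
    intro k
    rw [hH_def, Finset.mem_filter]
    refine ⟨fun h ↦ h.2, fun h ↦ ⟨?_, h⟩⟩
    obtain ⟨w, hwk, hwD⟩ := h
    exact mem_box_of_mem_cell hx hy hδ hwk (mem_closedBall.1 (hDr hwD))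
  -- cells of `H` lie in the disc; a cell of `H` and a cell off `H` only share points of `U`
  have hcell : ∀ k ∈ H, Icc (x k.1) (x (k.1 + 1)) ×ℂ Icc (y k.2) (y (k.2 + 1)) ⊆ ball (0 : ℂ) 1 := by
    intro k hk z hz
    obtain ⟨w, hwk, hwD⟩ := (hHmem k).1 hk
    have hzw : dist z w ≤ 2 * δ := dist_le_of_mem_cell hx hy hz hwk
    have hw : ‖w‖ ≤ r₀ := mem_closedBall_zero_iff.1 (hDr hwD)
    rw [mem_ball_zero_iff]
    calc ‖z‖ = ‖(z - w) + w‖ := by congr 1; ring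
      _ ≤ ‖z - w‖ + ‖w‖ := norm_add_le _ _
      _ < 1 := by rw [← dist_eq_norm]; linarith
  have hedge : ∀ k ∈ H, ∀ k' : ℤ × ℤ, k' ∉ H → ∀ z : ℂ,
      z ∈ Icc (x k.1) (x (k.1 + 1)) ×ℂ Icc (y k.2) (y (k.2 + 1)) →
      z ∈ Icc (x k'.1) (x (k'.1 + 1)) ×ℂ Icc (y k'.2) (y (k'.2 + 1)) → z ∈ U := by
    intro k hk k' hk' z hz hz'
    obtain ⟨w, hwk, hwD⟩ := (hHmem k).1 hk
    have hzD : z ∉ D := fun hzD ↦ hk' ((hHmem k').2 ⟨z, hz', hzD⟩)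
    -- the segment `[w, z]` inside the cell leaves `D`, so it meets `closure D ∖ D ⊆ K`
    have hconv : Convex ℝ (Icc (x k.1) (x (k.1 + 1)) ×ℂ Icc (y k.2) (y (k.2 + 1))) :=
      convex_reProdIm (convex_Icc _ _) (convex_Icc _ _)
    have hseg : segment ℝ w z ⊆ Icc (x k.1) (x (k.1 + 1)) ×ℂ Icc (y k.2) (y (k.2 + 1)) :=
      hconv.segment_subset hwk hz
    obtain ⟨v, hvs, hvcl, hvD⟩ : ∃ v ∈ segment ℝ w z, v ∈ closure D ∧ v ∉ D := by
      by_contra hno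
      push Not at hno
      have hsub : segment ℝ w z ⊆ D :=
        (convex_segment w z).isPreconnected.subset_of_closure_inter_subset hDo
          ⟨w, left_mem_segment ℝ w z, hwD⟩ (fun v hv ↦ hno v hv.2 hv.1)
      exact hzD (hsub (right_mem_segment ℝ w z))
    have hvK : v ∈ K := mem_of_mem_closure_component hK.isClosed hvcl hvD
    have hzv : dist z v ≤ 2 * δ := dist_le_of_mem_cell hx hy hz (hseg hvs)
    exact hηU (Metric.mem_thickening_iff.2 ⟨v, hvK, by linarith⟩)
  -- the pole `p` sits in the open cell of its index, which belongs to `H`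
  set kp : ℤ × ℤ := (⌊(p.re - a₁) / δ⌋, ⌊(p.im - a₂) / δ⌋) with hkp
  have hpcell : p ∈ Icc (x kp.1) (x (kp.1 + 1)) ×ℂ Icc (y kp.2) (y (kp.2 + 1)) :=
    mem_cell_floor hx hy hδ p
  have hpcello : p ∈ Ioo (x kp.1) (x (kp.1 + 1)) ×ℂ Ioo (y kp.2) (y (kp.2 + 1)) :=
    (mem_cello_of_not_mem_lines (hT₁ p hpT) (hT₂ p hpT) kp).resolve_right (fun h ↦ h hpcell)
  have hkpH : kp ∈ H := (hHmem kp).2 ⟨p, hpcell, hpD⟩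
  refine ⟨x, y, H, hxle, hyle, hcell, fun q hq k ↦ mem_cello_of_not_mem_lines (hT₁ q hq) (hT₂ q hq) k,
    ?_, ?_, ?_, ?_, kp, hkpH, hpcello⟩
  · -- bottom edges
    rintro k hk hk' _ ⟨t, ht, rfl⟩
    refine hedge k hk _ hk' _ ?_ ?_
    · simpa [mem_reProdIm] using ⟨ht, hyle k.2⟩
    · have e : y (k.2 - 1 + 1) = y k.2 := by rw [sub_add_cancel]
      have h1 : y (k.2 - 1) ≤ y k.2 := by simpa [sub_add_cancel] using hyle (k.2 - 1)
      simpa [mem_reProdIm, e] using ⟨ht, h1⟩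
  · -- top edges
    rintro k hk hk' _ ⟨t, ht, rfl⟩
    refine hedge k hk _ hk' _ ?_ ?_
    · simpa [mem_reProdIm] using ⟨ht, hyle k.2⟩
    · simpa [mem_reProdIm] using ⟨ht, hyle (k.2 + 1)⟩
  · -- left edges
    rintro k hk hk' _ ⟨t, ht, rfl⟩
    refine hedge k hk _ hk' _ ?_ ?_
    · simpa [mem_reProdIm] using ⟨hxle k.1, ht⟩
    · have e : x (k.1 - 1 + 1) = x k.1 := by rw [sub_add_cancel]
      have h1 : x (k.1 - 1) ≤ x k.1 := by simpa [sub_add_cancel] using hxle (k.1 - 1)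
      simpa [mem_reProdIm, e] using ⟨h1, ht⟩
  · -- right edges
    rintro k hk hk' _ ⟨t, ht, rfl⟩
    refine hedge k hk _ hk' _ ?_ ?_
    · simpa [mem_reProdIm] using ⟨hxle k.1, ht⟩
    · simpa [mem_reProdIm] using ⟨hxle (k.1 + 1), ht⟩

/-- The pole candidates `u i`, `(u i)⁻¹` of a countable family form a countable set. -/
theorem countable_poleCandidates {ι : Type*} [Countable ι] (u : ι → ℂ) :
    {q : ℂ | ∃ i, q = u i ∨ q = (u i)⁻¹}.Countable := by
  have e : {q : ℂ | ∃ i, q = u i ∨ q = (u i)⁻¹} = Set.range u ∪ Set.range (fun i ↦ (u i)⁻¹) := by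
    ext q
    simp only [mem_setOf_eq, mem_union, mem_range]
    constructor
    · rintro ⟨i, h1 | h1⟩
      · exact Or.inl ⟨i, h1.symm⟩
      · exact Or.inr ⟨i, h1.symm⟩
    · rintro (⟨i, h1⟩ | ⟨i, h1⟩)
      · exact ⟨i, Or.inl h1.symm⟩
      · exact ⟨i, Or.inr h1.symm⟩
  rw [e]
  exact (Set.countable_range _).union (Set.countable_range _)

/-- **GAUSS'S LAW FOR COMPACTA (ζ-free).**  `c` absolutely summable with `Re (c i) < 0`, `u i ≠ 0`;
`F` holomorphic on the unit disc and equal to the Borel series on a pole-free disc `ball 0 r₀`; `Ω₀`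
the connected component of `0` in `𝔻 ∖ closure (poleSet u)`.  Then NO compact `K ⊆ Ω₀` links an
inside pole: every inside pole `p ∉ K` has an unbounded component in `ℂ ∖ K` (the compactum would be
shadowed by a wall-free grid cycle of `Ω₀` around `p`, against Gauss's law for grid cycles
`ScrewDust.false_of_cellComplex`).  The circle law `ScrewBorelGauss.poleSet_inter_ball_eq_empty` is
the case `K = sphere a R`. -/
theorem not_isBounded_component_of_compact {ι : Type*} {c u : ι → ℂ}
    (hc : Summable fun i ↦ ‖c i‖) (hre : ∀ i, (c i).re < 0) (hu : ∀ i, u i ≠ 0) {F : ℂ → ℂ}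
    (hF : DifferentiableOn ℂ F (ball 0 1)) {r₀ : ℝ} (hr₀ : 0 < r₀)
    (hS : ∀ p ∈ poleSet u, r₀ ≤ ‖p‖)
    (hFB : EqOn F (fun z ↦ ∑' i, ScrewBorel.term (c i) (u i) z) (ball 0 r₀))
    {K : Set ℂ} (hK : IsCompact K)
    (hKΩ : K ⊆ connectedComponentIn (ball (0 : ℂ) 1 \ closure (poleSet u)) 0)
    {p : ℂ} (hp : p ∈ poleSet u) (hpK : p ∉ K) : ¬ IsBounded (connectedComponentIn Kᶜ p) := by
  intro hD
  haveI : Countable ι := ScrewBorelFlux.countable_of_summable_of_re_neg hc hre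
  have hΩo : IsOpen (connectedComponentIn (ball (0 : ℂ) 1 \ closure (poleSet u)) 0) :=
    (isOpen_ball.sdiff isClosed_closure).connectedComponentIn
  have hpT : p ∈ {q : ℂ | ∃ i, q = u i ∨ q = (u i)⁻¹} := hp.2
  obtain ⟨x, y, H, hx, hy, hcell, hgp, hbot, htop, hlef, hrig, k, hk, hpk⟩ :=
    exists_cellComplex_of_isBounded_component (countable_poleCandidates u) hΩo
      (fun z hz ↦ (connectedComponentIn_subset _ _ hz).1) hK hKΩ hpT hpK hD
  exact false_of_cellComplex hc hre hu hF hr₀ hS hFB isPreconnected_connectedComponentIn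
    (ScrewBorelGauss.zero_mem_component hr₀ hS) (connectedComponentIn_subset _ _) hx hy hcell
    (fun i k _ q hq ↦ hgp q ⟨i, hq⟩ k) hbot htop hlef hrig hp hk hpk

end Summit.RiemannHypothesis.RiemannHypothesis.Theorems.Splittings.ScrewDust

/-! ## 2. The linked row `CEIL(h) ∧ LINKED(h) ⟺ RH` and Gauss's law for compacta -/

namespace Summit.RiemannHypothesis.RiemannHypothesis.Theorems.Splittings.ScrewLatticeCycleGauss

open Complex Filter Topology Set Metric Bornology
open Literature.NumberTheory.LFunctions
open Summit.RiemannHypothesis.RiemannHypothesis.Theorems.Splittings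
open Summit.RiemannHypothesis.RiemannHypothesis.Theorems.Splittings.ScrewBorel
open Summit.RiemannHypothesis.RiemannHypothesis.Theorems.Splittings.ScrewLatticeContinuation
open Summit.RiemannHypothesis.RiemannHypothesis.Theorems.Splittings.ScrewLatticeThinWall
open Summit.RiemannHypothesis.RiemannHypothesis.Theorems.Splittings.ScrewLatticeGauss
open Summit.RiemannHypothesis.RiemannHypothesis.Theorems.Splittings.ScrewDust

/-- `LINKED(h)`: if there are aliased far zeros in `𝔻` at all, then some COMPACT subset `K` of the
origin's component `Ω₀(h)` of `𝔻 ∖ T_h` LINKS one of them — an aliased far zero `p ∉ K` whose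
connected component in `ℂ ∖ K` is bounded.  Open; RH-implied (vacuously, `linked_of_rh`); implied by
`ENC(h)` (`linked_of_encirclable`: a circle links the points inside it); implies `CENC(h)`
(`cycleEncirclable_of_linked`). -/
@[conjecture] def Linked (h : ℝ) : Prop :=
  (aliasedPoleSet h).Nonempty → ∃ K : Set ℂ, IsCompact K ∧ K ⊆ originComponent h ∧
    ∃ p ∈ aliasedPoleSet h, p ∉ K ∧ IsBounded (connectedComponentIn Kᶜ p)

/-- **RH ⟹ LINKED(h)** (vacuously: no aliased far zeros). -/
theorem linked_of_rh (hRH : RiemannHypothesis) (h : ℝ) : Linked h := by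
  intro hne
  rw [aliasedPoleSet_eq_empty_of_rh hRH] at hne
  exact absurd hne Set.not_nonempty_empty

/-- **LINKED(h) ⟹ CENC(h)**: a linked compactum of `Ω₀(h)` is shadowed by a wall-free grid cycle of
`Ω₀(h)` around the same far zero. -/
theorem cycleEncirclable_of_linked {h : ℝ} (hl : Linked h) : CycleEncirclable h := by
  intro hne
  obtain ⟨K, hK, hKΩ, p, hp, hpK, hD⟩ := hl hne
  have hpT : p ∈ {q : ℂ | ∃ ρ : ZetaZeros.riemannZetaNontrivialZeros,
      q = mult h ρ ∨ q = (mult h ρ)⁻¹} := hp.2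
  obtain ⟨x, y, H, hx, hy, hcell, hgp, hbot, htop, hlef, hrig, k, hk, hpk⟩ :=
    exists_cellComplex_of_isBounded_component (countable_mults h) (isOpen_originComponent h)
      (fun z hz ↦ (originComponent_subset h hz).1) hK hKΩ hpT hpK hD
  exact ⟨x, y, H, hx, hy, hcell, fun ρ k _ q hq ↦ hgp q ⟨ρ, hq⟩ k, hbot, htop, hlef, hrig, p, hp,
    k, hk, hpk⟩

/-- **`CEIL(h) ∧ LINKED(h) ⟹ RH`** (`h > 0`). -/
theorem rh_of_latticeCeiling_of_linked {h : ℝ} (hh : 0 < h) (hceil : LatticeCeiling h)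
    (hl : Linked h) : RiemannHypothesis :=
  rh_of_latticeCeiling_of_cycleEncirclable hh hceil (cycleEncirclable_of_linked hl)

/-- **THE LINKED ROW**, `h > 0` arbitrary: `CEIL(h) ∧ LINKED(h) ↔ RiemannHypothesis`. -/
theorem latticeCeiling_and_linked_iff_rh {h : ℝ} (hh : 0 < h) :
    (LatticeCeiling h ∧ Linked h) ↔ RiemannHypothesis :=
  ⟨fun hab ↦ rh_of_latticeCeiling_of_linked hh hab.1 hab.2,
    fun hRH ↦ ⟨latticeCeiling_of_rh hRH h, linked_of_rh hRH h⟩⟩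

/-- **GAUSS'S LAW FOR COMPACTA (the RH-free dichotomy)**, `h > 0`: under `CEIL(h)`, EITHER the Riemann
hypothesis holds OR there are aliased far zeros and every one of them lies, for every compact
`K ⊆ Ω₀(h)` not containing it, in an UNBOUNDED component of `ℂ ∖ K` — no compact piece of the origin's
component links a far zero. -/
theorem latticeCeiling_dichotomy_linked {h : ℝ} (hh : 0 < h) (hceil : LatticeCeiling h) :
    RiemannHypothesis ∨ ((aliasedPoleSet h).Nonempty ∧ ∀ K : Set ℂ, IsCompact K →
      K ⊆ originComponent h → ∀ p ∈ aliasedPoleSet h, p ∉ K →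
        ¬ IsBounded (connectedComponentIn Kᶜ p)) := by
  by_cases hRH : RiemannHypothesis
  · exact Or.inl hRH
  · refine Or.inr ⟨aliasedPoleSet_nonempty_of_not_rh hh hRH, fun K hK hKΩ p hp hpK hD ↦ hRH ?_⟩
    exact rh_of_latticeCeiling_of_linked hh hceil fun _ ↦ ⟨K, hK, hKΩ, p, hp, hpK, hD⟩

/-- The component of an inside point in the complement of a circle is the open disc (so it is
bounded): a circle links the points inside it. -/
theorem connectedComponentIn_compl_sphere_subset {a p : ℂ} {R : ℝ} (hp : p ∈ ball a R) :
    connectedComponentIn (sphere a R)ᶜ p ⊆ ball a R := by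
  have hsub : (sphere a R)ᶜ ⊆ ball a R ∪ (closedBall a R)ᶜ := by
    intro z hz
    rw [mem_compl_iff, mem_sphere] at hz
    rcases lt_or_gt_of_ne hz with h | h
    · exact Or.inl (mem_ball.2 h)
    · exact Or.inr (fun hz' ↦ absurd (mem_closedBall.1 hz') (not_le.2 h))
  exact isPreconnected_connectedComponentIn.subset_left_of_subset_union isOpen_ball
    isClosed_closedBall.isOpen_compl
    (Set.disjoint_left.2 fun z hz hz' ↦ hz' (ball_subset_closedBall hz))
    ((connectedComponentIn_subset _ _).trans hsub)
    ⟨p, mem_connectedComponentIn (fun h ↦ by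
      have := mem_sphere.1 h; have := mem_ball.1 hp; linarith), hp⟩

/-- **ENC(h) ⟹ LINKED(h)**: the enclosing circle is a linked compactum of `Ω₀(h)`. -/
theorem linked_of_encirclable {h : ℝ} (henc : Encirclable h) : Linked h := by
  intro hne
  obtain ⟨a, R, hR, haR, hS, p, hp, hpa⟩ := henc hne
  refine ⟨sphere a R, isCompact_sphere a R, hS, p, hp, fun h ↦ ?_, ?_⟩
  · have := mem_sphere.1 h; have := mem_ball.1 hpa; linarith
  · exact isBounded_ball.subset (connectedComponentIn_compl_sphere_subset hpa)

/-- **LASSO(h) ⟹ LINKED(h)** and **TW(h) ⟹ LINKED(h)** (`h ≥ 0`) through `ENC(h)`. -/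
theorem linked_of_lasso {h : ℝ} (hl : Lasso h) : Linked h :=
  linked_of_encirclable (encirclable_of_lasso hl)

/-- **TW(h) ⟹ LINKED(h)** (`h ≥ 0`). -/
theorem linked_of_thinWall {h : ℝ} (hh : 0 ≤ h) (htw : ThinWall h) : Linked h :=
  linked_of_encirclable (encirclable_of_thinWall hh htw)

end Summit.RiemannHypothesis.RiemannHypothesis.Theorems.Splittings.ScrewLatticeCycleGauss
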